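import Summits.AtomisticToContinuum.Crystallization.Theses.SoftAnnulusKernel
import Summits.AtomisticToContinuum.Crystallization.Theorems.SoftAnnulusKernelSoftLocalFloor

/-!
# Birth skeleton for the crux `SoftLocalTwelveFourCommon` (route SoftAnnulusKernel, item stmt-AtomisticToContinuum-18404)

Line **soft-annulus** (registered as `Lines/birth.lean`; the route's own foreseen split, route file
§ TWO-LAYER PLAN): *soft `L12` ⟹ soft gap dichotomy in every twelve-coordinated shell ⟹ soft Hales
shell lemma in COUNT form*.  The crux reads: for `η ∈ [0, 10⁻³]` and a `(1−η)`-separated `Z ⊂ ℝ³`, if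
`z ∈ Z` and every point of `Z` within `1+η` of `z` has exactly twelve other points of `Z` within `1+η`,
then every soft neighbour `z'` of `z` has `≥ 4` points of `Z` within `1+η` of both `z` and `z'`.

* `stub_softTwelveGap` — SOFT `L12` GAP (Hales 2012 Lemma 1 ⟹ Lemma 2 made soft; size M given the
  named fact `Literature.Geometry.DiscreteGeometry.flyspeck_L12`, XL unconditionally): in a
  `(1−η)`-separated `Z` (`0 ≤ η ≤ 10⁻³`) a point `u` with exactly twelve other points within `1+η` has
  every other point of `Z` within `1+η` or at distance `≥ 63/50 − 26η` (`= 1.234` at `η = 10⁻³`).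
  DISCHARGED MODULO THE NAMED FACT by the landed support theorem
  `Theorems.softTwelveGap_of_flyspeckL12` (p168757, ACCEPTED; axioms standard) — see the first
  `example` of §3 below (no `sorry`).  Unconditional closure = a Lean proof of the Flyspeck
  local annulus inequality (DSP estimate (6.95) `∑ L(h) ≤ 12`, HOL-Light verified 2014;
  the tree's `CountingSpheres` provefact programme), or a direct thirteen-point argument at these
  margins (Tammes-13 margin 57.14° does NOT suffice: radii up to `1.234` allow angular separation
  down to `47.8°`, so the weighted inequality is genuinely what is used).
* `stub_softShellFourContacts` — SOFT HALES SHELL LEMMA, COUNT FORM (effective Hales 2012 Theorem 3 +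
  Lemmas 9–10 at gap `63/50 − 26η`, tolerance `10⁻³`; size XL, certificate technology; THE
  LOAD-BEARING STUB): twelve points `T ⊂ ℝ³` with norms in `[1−η, 1+η]`, pairwise `≥ 1−η`, and every
  pair either a soft contact (`≤ 1+η`) or `≥ 63/50 − 26η` apart, have `≥ 4` soft contacts EACH inside
  `T`.  At `η = 0` it is PROVED in tree (`Theorems.shellFourContacts_zero`, p168790: `2 • T` is a
  kissing configuration of Hales's class `𝒱`, congruent to the FCC or HCP pattern by
  `kissingConfigCongruent_of_contactGraphTame Hales2012_contactGraphTame_holds`, both patterns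
  `4`-regular by `decide` on the integer models).  For `0 < η ≤ 10⁻³`: by compactness of the
  hypothesis set and the closedness of the `η = 0` alternatives, SOME `η₀ > 0` works (soft contacts
  converge to the limit pattern's 24 contacts, non-contacts stay `≥ 1.26 − o(1)`); the stub is the
  EFFECTIVE claim `η₀ ≥ 10⁻³` — re-run of Hales's node-type / hypermap / LP exclusions (tree:
  KissingNodeTypes, KissingCornerBounds, KissingLPTables, KissingMainEstimate, TameContactGraphs,
  KissingSearch `checkPart 5 128 i 60`, `κ₀ = 1031/5000`) with contact cells `[1−η, 1+η]` and
  long-side cosine threshold `κ(η) = 1 − (63/50 − 26η)²/2 = 0.2378`.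

`SoftLocalTwelveFourCommon_of : SoftLocalTwelveFourCommon` is THE SKELETON THEOREM (registered form:
concludes the route decl BY NAME, no hypotheses, `sorry` only through the two declared `stub_*`;
`#print axioms` reaches `sorryAx` exactly through `stub_softTwelveGap` and `stub_softShellFourContacts`).
The HYPOTHESIS FORM `stub_A-sig → stub_B-sig → SoftLocalTwelveFourCommon` (real proof, no `sorry`,
hypotheses = the two stub signatures character for character) is the `example` right above it — kept
as an `example` so that `SoftLocalTwelveFourCommon_of` is the file's ONLY declaration concluding the crux
by name (the skeleton checker admits no inlined `Prop` binders there).  Both are the landed support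
theorem `Theorems.softLocalFourCommon_of_gap_of_shell` (p168790, ACCEPTED, axioms `propext`,
`Classical.choice`, `Quot.sound`) at `ηmax = 1/1000` — translate the soft shell of `z` to the origin,
read norms / separation off the `(1−η)`-separation of `Z`, get the dichotomy between shell points from
Stub A applied AT THE SHELL POINT (twelve-coordinated by hypothesis), apply Stub B at the shell point
`z' − z`, and push the four contacts back into `Z`.

Why the cut is honest (no shredding, no costume): Stub A is about ONE twelve-coordinated centre in an
arbitrary separated set (a thirteen-point statement), Stub B about ONE abstract twelve-point shell with
the dichotomy already given (no ambient set, no coordination hypothesis on the shell points); neither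
mentions the crux's two-centre hypothesis "every soft neighbour of `z` is twelve-coordinated", and the
crux does not give Stub B back cheaply (`T ∪ {0}` violates that hypothesis at the shell points).
BC3 probes (this registration, `bc/probe_*.lean`): `stub → SoftLocalTwelveFourCommon` and
`stub → Crystallization` under `first | exact? | simpa | aesop` FAIL for both stubs.

Disproof.lean for this crux: none on file at registration (`ledger crux ls stmt-AtomisticToContinuum-18404`:
no workfiles); no `_false_without_` obstruction to honour yet.  Negatives index checked (23 entries):
the two shell-type negatives are 15929 (`GappedShellCensus.ShellCensus`, tolerance `1/50`: the TORN
ICOSAHEDRON, which has vertices of soft degree `3` and `2` and so WOULD refute a count-form shell lemma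
— but it needs tolerance `≥ 1.77 %` at gap `63/50`; each of its seven icosahedral caps is a closed ring
of five tetrahedra about a spoke, impossible below the decahedral threshold `η⋆ ≈ 0.67 %`) and 4146
(`BrittleMieDescent.EffectiveLocalHales`, tolerance `1/100`: the `D₅ₕ` shell, `η⋆ ≈ 0.0067`; its
degrees are `4` and `5`, so it even satisfies the count form).  Stub B sits at tolerance `0.1 %`, below
both thresholds; the route's KILL CRITERION is exactly a Stub-B counterexample at `10⁻³` (retreat once
to `10⁻⁴`, gap `1.2575`).

Sources: arXiv:1209.6043 (Hales 2012: Lemma 1 = weighted `L12`, Lemma 2 = gap, Theorem 3 + Lemmas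
9–10 = classification of class `𝒱`); doi:10.1017/cbo9781139193894 (DSP: `L(h)` Def. p. 149, estimate
(6.95) `∑ L(h) ≤ 12` p. 150, reused in Lemma 8.56 p. 207); arXiv:1501.02155 §4.2 (formal proof, local
annulus inequality); arXiv:1407.0692 §2.1 (Flatley–Theil, the two-centre context);
doi:10.1016/j.cam.2013.03.036 (24-contact rigidity).  Presearch (corpus fts+vec and galaxy,
2026-08-17): no soft / effective version of either stub in print — hits are the `η = 0` statements
only ([corpus:book:hales2012-dense-sphere-packings-blueprint-formal-proofs p.149–150, 155, 207],
[galaxy:panama:506136126029833] = DSP, [galaxy:panama:196554883334198] Bezdek, Classical Topics).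
-/

namespace Summit.AtomisticToContinuum.Crystallization.Cruxes.SoftLocalTwelveFourCommon.Birth

open Literature.Geometry.DiscreteGeometry

/-! ## §1 Registered stubs (the ONLY `sorry`s of the file; signatures fully inlined) -/

/-- **Stub A — soft `L12` gap (Hales 2012 Lemma 2 made soft).**  `η ∈ [0, 10⁻³]`; `Z ⊂ ℝ³` is
`(1−η)`-separated; `u ∈ Z` has exactly twelve other points of `Z` within `1+η`.  Then every
`v ∈ Z ∖ {u}` satisfies `dist v u ≤ 1+η` or `63/50 − 26η ≤ dist v u` — an empty annulus
`(1+η, 1.26 − 26η)` around `u` (`(1.001, 1.234)` at `η = 10⁻³`).  Why plausibly true: it FOLLOWS from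
the named fact `flyspeck_L12` (rescale the thirteen points by `2/(1−η)` about `u`: the twelve soft
neighbours weigh `≥ L((1+η)/(1−η))` each, a thirteenth point below the bound weighs more than the
remaining budget) — landed as `Theorems.softTwelveGap_of_flyspeckL12` (first `example` of §3).
Size M given `flyspeck_L12`; XL unconditionally (= the Flyspeck local annulus inequality).
Sources: arXiv:1209.6043 Lemmas 1–2; doi:10.1017/cbo9781139193894 (6.95); arXiv:1501.02155 §4.2. -/
theorem stub_softTwelveGap :
    ∀ η : ℝ, 0 ≤ η → η ≤ 1 / 1000 → ∀ Z : Set (EuclideanSpace ℝ (Fin 3)), (∀ x ∈ Z, ∀ y ∈ Z, x ≠ y → 1 - η ≤ dist x y) → ∀ u ∈ Z, {w ∈ Z | w ≠ u ∧ dist w u ≤ 1 + η}.ncard = 12 → ∀ v ∈ Z, v ≠ u → dist v u ≤ 1 + η ∨ (63 / 50 - 26 * η : ℝ) ≤ dist v u := by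
  sorry

/-- **Stub B — soft Hales shell lemma, count form (effective Hales 2012 Theorem 3 + Lemmas 9–10 at
gap `63/50 − 26η`, tolerance `10⁻³`).**  `η ∈ [0, 10⁻³]`; `T ⊂ ℝ³` has twelve points with norms in
`[1−η, 1+η]`; distinct points of `T` are `≥ 1−η` apart and EITHER a soft contact (`≤ 1+η`) OR
`≥ 63/50 − 26η` apart.  Then every `y ∈ T` has at least four soft contacts `y' ∈ T ∖ {y}`,
`dist y' y ≤ 1+η`.  Why plausibly true: at `η = 0` it is PROVED (`Theorems.shellFourContacts_zero`:
`2 • T ∈ 𝒱`, Hales's classification `Hales2012_contactGraphTame_holds` +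
`kissingConfigCongruent_of_contactGraphTame`, FCC/HCP patterns `4`-regular); for small `η > 0` some
`η₀ > 0` works by compactness (soft contact graph = limit contact graph, which is `4`-regular); the
claim is the effective constant `η₀ ≥ 10⁻³`, where Hales's node-type / hypermap / LP exclusions keep
positive margins (gap arc `76.25°` vs `78.10°`; five contacts at a vertex need `4·70.53° + 90.9° >
360°`; decahedral ring closure only at `η⋆ ≈ 0.0067`; torn icosahedra only at `≥ 1.77 %`).  Why it
might fail: a twelve-point soft-dichotomy configuration at `10⁻³` with a vertex of soft degree `≤ 3`
(the route's KILL CRITERION; retreat `10⁻⁴`).  Size XL (interval / LP certificates over Hales's node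
types at the soft parameters; template = the tree's `η = 0` infrastructure KissingNodeTypes,
KissingCornerBounds, KissingLPTables, KissingMainEstimate, TameContactGraphs, KissingSearch with
`κ(η) = 0.2378` in place of `κ₀ = 1031/5000`).  Sources: arXiv:1209.6043 Thm 3, Lemmas 9–10;
doi:10.1016/j.cam.2013.03.036; arXiv:1407.0692 §2.1. -/
theorem stub_softShellFourContacts :
    ∀ η : ℝ, 0 ≤ η → η ≤ 1 / 1000 → ∀ T : Finset (EuclideanSpace ℝ (Fin 3)), T.card = 12 → (∀ y ∈ T, 1 - η ≤ ‖y‖ ∧ ‖y‖ ≤ 1 + η) → (∀ y ∈ T, ∀ y' ∈ T, y ≠ y' → 1 - η ≤ dist y y') → (∀ y ∈ T, ∀ y' ∈ T, y ≠ y' → dist y y' ≤ 1 + η ∨ (63 / 50 - 26 * η : ℝ) ≤ dist y y') → ∀ y ∈ T, 4 ≤ {y' ∈ (T : Set (EuclideanSpace ℝ (Fin 3))) | y' ≠ y ∧ dist y' y ≤ 1 + η}.ncard := by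
  sorry

/-! ## §2 Composition (kernel-checked): the stubs imply the crux BY NAME -/

/-- **HYPOTHESIS FORM (BC3 letter; sorry-free, real proof): Stub A → Stub B → `SoftLocalTwelveFourCommon`**
(hypotheses = the §1 signatures character for character; conclusion = the route decl by name).  This is
the landed support theorem `Theorems.softLocalFourCommon_of_gap_of_shell` (uniform in the tolerance
range, here `ηmax = 1/1000`): translate the soft shell `N` of `z` by `−z` to a twelve-point `T`; norms in
`[1−η, 1+η]` and pairwise separation `≥ 1−η` come from the `(1−η)`-separation of `Z`; for shell points
`y ≠ y'` Stub A at the centre `y` (twelve-coordinated, being a soft neighbour of `z`) gives the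
dichotomy; Stub B at `z' − z ∈ T` gives four soft contacts inside `T`, which are (translates of) points
of `Z` within `1+η` of both `z` and `z'`.  Kept as an `example` so that `SoftLocalTwelveFourCommon_of`
below is the file's ONLY declaration concluding the crux by name. -/
example :
    (∀ η : ℝ, 0 ≤ η → η ≤ 1 / 1000 → ∀ Z : Set (EuclideanSpace ℝ (Fin 3)), (∀ x ∈ Z, ∀ y ∈ Z, x ≠ y → 1 - η ≤ dist x y) → ∀ u ∈ Z, {w ∈ Z | w ≠ u ∧ dist w u ≤ 1 + η}.ncard = 12 → ∀ v ∈ Z, v ≠ u → dist v u ≤ 1 + η ∨ (63 / 50 - 26 * η : ℝ) ≤ dist v u) →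
    (∀ η : ℝ, 0 ≤ η → η ≤ 1 / 1000 → ∀ T : Finset (EuclideanSpace ℝ (Fin 3)), T.card = 12 → (∀ y ∈ T, 1 - η ≤ ‖y‖ ∧ ‖y‖ ≤ 1 + η) → (∀ y ∈ T, ∀ y' ∈ T, y ≠ y' → 1 - η ≤ dist y y') → (∀ y ∈ T, ∀ y' ∈ T, y ≠ y' → dist y y' ≤ 1 + η ∨ (63 / 50 - 26 * η : ℝ) ≤ dist y y') → ∀ y ∈ T, 4 ≤ {y' ∈ (T : Set (EuclideanSpace ℝ (Fin 3))) | y' ≠ y ∧ dist y' y ≤ 1 + η}.ncard) →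
    Summit.AtomisticToContinuum.Crystallization.Theses.SoftAnnulusKernel.SoftLocalTwelveFourCommon := by
  intro hGap hShell
  unfold Summit.AtomisticToContinuum.Crystallization.Theses.SoftAnnulusKernel.SoftLocalTwelveFourCommon
  exact Summit.AtomisticToContinuum.Crystallization.Theorems.softLocalFourCommon_of_gap_of_shell hGap hShell

/-- **THE SKELETON THEOREM** (registered form: concludes the route decl `SoftLocalTwelveFourCommon` BY
NAME, no hypotheses, `sorry` only through the two declared `stub_*`):
`SoftLocalTwelveFourCommon_of = softLocalFourCommon_of_gap_of_shell stub_softTwelveGap stub_softShellFourContacts`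
(`#print axioms` reaches `sorryAx` exactly through the two stubs). -/
theorem SoftLocalTwelveFourCommon_of :
    Summit.AtomisticToContinuum.Crystallization.Theses.SoftAnnulusKernel.SoftLocalTwelveFourCommon := by
  unfold Summit.AtomisticToContinuum.Crystallization.Theses.SoftAnnulusKernel.SoftLocalTwelveFourCommon
  exact Summit.AtomisticToContinuum.Crystallization.Theorems.softLocalFourCommon_of_gap_of_shell
    stub_softTwelveGap stub_softShellFourContacts

/-! ## §3 What is already discharged (no `sorry`; `example`s, so that no further declaration concludes
the crux): Stub A modulo the named fact `flyspeck_L12`, hence the crux from `flyspeck_L12` + Stub B.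
(The `η = 0` FLOOR of the whole crux is the landed `Theorems.softLocalTwelveFourCommon_floor_of_L12`;
Stub B at `η = 0` is `Theorems.shellFourContacts_zero`.) -/

/-- **Stub A modulo the named fact `flyspeck_L12`** (landed: `Theorems.softTwelveGap_of_flyspeckL12`,
p168757). -/
example (hL12 : flyspeck_L12) :
    ∀ η : ℝ, 0 ≤ η → η ≤ 1 / 1000 → ∀ Z : Set (EuclideanSpace ℝ (Fin 3)), (∀ x ∈ Z, ∀ y ∈ Z, x ≠ y → 1 - η ≤ dist x y) → ∀ u ∈ Z, {w ∈ Z | w ≠ u ∧ dist w u ≤ 1 + η}.ncard = 12 → ∀ v ∈ Z, v ≠ u → dist v u ≤ 1 + η ∨ (63 / 50 - 26 * η : ℝ) ≤ dist v u :=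
  Summit.AtomisticToContinuum.Crystallization.Theorems.softTwelveGap_of_flyspeckL12 hL12

/-- **The crux from the named fact and Stub B alone** (so a prover closing `stub_softShellFourContacts`
closes the crux conditionally on `flyspeck_L12`, and unconditionally once `L12` is a theorem). -/
example (hL12 : flyspeck_L12)
    (hShell : ∀ η : ℝ, 0 ≤ η → η ≤ 1 / 1000 → ∀ T : Finset (EuclideanSpace ℝ (Fin 3)), T.card = 12 → (∀ y ∈ T, 1 - η ≤ ‖y‖ ∧ ‖y‖ ≤ 1 + η) → (∀ y ∈ T, ∀ y' ∈ T, y ≠ y' → 1 - η ≤ dist y y') → (∀ y ∈ T, ∀ y' ∈ T, y ≠ y' → dist y y' ≤ 1 + η ∨ (63 / 50 - 26 * η : ℝ) ≤ dist y y') → ∀ y ∈ T, 4 ≤ {y' ∈ (T : Set (EuclideanSpace ℝ (Fin 3))) | y' ≠ y ∧ dist y' y ≤ 1 + η}.ncard) :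
    Summit.AtomisticToContinuum.Crystallization.Theses.SoftAnnulusKernel.SoftLocalTwelveFourCommon := by
  unfold Summit.AtomisticToContinuum.Crystallization.Theses.SoftAnnulusKernel.SoftLocalTwelveFourCommon
  exact Summit.AtomisticToContinuum.Crystallization.Theorems.softLocalFourCommon_of_gap_of_shell
    (Summit.AtomisticToContinuum.Crystallization.Theorems.softTwelveGap_of_flyspeckL12 hL12) hShell

end Summit.AtomisticToContinuum.Crystallization.Cruxes.SoftLocalTwelveFourCommon.Birth
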